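import Literature.AlgebraicGeometry.HodgeTheory.FermatHodgeCharacterCriterion
import HarnessLib

/-!
# The Hodge condition at an EVEN conductor `F` prime to `3`, met at the exact levels `F`, `2F`, `3F`, `6F` — Aoki 1983, Prop. 2.2

Topic `Literature/AlgebraicGeometry/HodgeTheory`. THEOREMS only (no definition, no named fact, no `sorry`).
Support file (XXVII), the even-conductor companion of `FermatHodgeCharacterSixthConductor` (XXV: `f` prime
to `6`) and the `3`-analogue of `FermatHodgeCharacterEvenHalf` (XXII): here the conductor `F` is EVEN and
prime to `3`, and the levels meeting it are among `F`, `2F`, `3F`, `6F` — automatic at a level `m` with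
`F = m/6` (`12 ∣ m`, `9 ∤ m`). Since `2 ∣ F`, `χ(2) = 0` for a character mod `F` and the Euler factor at `2`
disappears: the level `6F` carries the factor `1 - χ(3)` and weight `1`, the level `3F` the factor
`1 - χ(3)` and weight `2`, the level `2F` no factor and weight `2`, the level `F` weight `4`
(`φ(2F) = 2φ(F)`, `φ(3F) = 2φ(F)`, `φ(6F) = 4φ(F)`). This is Aoki's "considering `τ₆(α)` we get `δ' = 1`"
for `ord₂ m > 2` ([Aoki1983, Thm. C] §9 (III-7) p. 50) — the relation needed by the route K₂₄ (`8 ∣ m`,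
`3 ∥ m`) of the cell's scoping document (§18), where `F = m/6` is divisible by `4`.

For a Hodge character `α : Fin r → ℤ/m`, `αᵢ = (m/Mᵢ) wᵢ` (`Mᵢ ∣ m` the exact level, `wᵢ` a unit mod `Mᵢ`),
`F ∣ m` with `2 ∣ F`, `3 ∤ F` such that every `Mᵢ` divisible by `F` is one of `F, 2F, 3F, 6F`, and an odd
primitive character `χ` mod `F` — **`IsHodge.rel_sixth_conductor_even_conj`** —
`∑_{Mᵢ = 6F} (1 - conj χ(3)) χ(w̄ᵢ) + 2 ∑_{Mᵢ = 3F} (1 - conj χ(3)) χ(w̄ᵢ) + 2 ∑_{Mᵢ = 2F} χ(w̄ᵢ)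
  + 4 ∑_{Mᵢ = F} χ(w̄ᵢ) = 0` (`w̄ᵢ = wᵢ mod F`); with `3v₃ = -1`: `3`-twins `w̄, v₃w̄` of weight `1` (level
`6F`) and `2` (level `3F`), singles of weight `2` (level `2F`) and `4` (level `F`).
**`IsHodge.rel_sixth_level_even`**: the same at a level `m = 6F` (every `Mᵢ ∣ m` divisible by `F` is
automatically among `F, 2F, 3F, 6F`).

HONEST FRAMING (cell `pub-hfermat`): explicit algebraic cycles for specific Hodge classes on
Fermat/Delsarte varieties; residual open instances listed; no claim on general Hodge. (Surface
classes are algebraic by Lefschetz (1,1); this file is a relation among Hodge characters, no case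
of HC.)

## References
* [Aoki1983] N. Aoki, *On some arithmetic problems related to the Hodge cycles on the Fermat varieties*,
  Math. Ann. 266 (1983) 23–54 — Props. 2.1, 2.2 (pp. 28–29), §9 (III-7) p. 50 ("considering `τ₆(α)`").
-/

noncomputable section

open Finset

namespace Literature.AlgebraicGeometry.HodgeTheory

namespace FermatCharacter

section SixthConductorEven

variable {m : ℕ}

/-- `χ` vanishes at the primes of its level: `∏_{p ∣ f} (1 - χ(p)) = 1`. [folklore] -/
private theorem prod_primeFactors_one_sub_eq_one₂₇ {f : ℕ} (χ : DirichletCharacter ℂ f) :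
    ∏ p ∈ f.primeFactors, (1 - χ (p : ZMod f)) = 1 := by
  refine Finset.prod_eq_one fun p hp ↦ ?_
  have hpf : p ∣ f := Nat.dvd_of_mem_primeFactors hp
  have hp1 : p.Prime := Nat.prime_of_mem_primeFactors hp
  have hnu : ¬ IsUnit ((p : ℕ) : ZMod f) := by
    rw [ZMod.isUnit_iff_coprime]
    intro hc
    exact hp1.one_lt.ne' (Nat.Coprime.eq_one_of_dvd hc hpf)
  rw [χ.map_nonunit hnu, sub_zero]

/-- At an even level `F`, `χ(2) = 0`. [folklore] -/
private theorem apply_two_eq_zero₂₇ {F : ℕ} (h2 : 2 ∣ F) (χ : DirichletCharacter ℂ F) : χ 2 = 0 := by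
  have hnu : ¬ IsUnit ((2 : ℕ) : ZMod F) := by
    rw [ZMod.isUnit_iff_coprime]
    intro hc
    exact absurd (Nat.Coprime.eq_one_of_dvd hc h2) (by norm_num)
  rw [show (2 : ZMod F) = ((2 : ℕ) : ZMod F) by norm_cast]
  exact χ.map_nonunit hnu

/-- **[Aoki1983, Prop. 2.2] at an EVEN conductor `F` prime to `3`, met only at the exact levels
`F, 2F, 3F, 6F`.** Let `α = (α₀, …, α_{r-1})` be a Hodge character of level `m`, `αᵢ = (m/Mᵢ) wᵢ` with
`Mᵢ ∣ m` and `wᵢ` a unit mod `Mᵢ`, and let `F ∣ m` with `2 ∣ F`, `3 ∤ F` be such that every `Mᵢ`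
divisible by `F` is `F`, `2F`, `3F` or `6F`. Then for every odd primitive character `χ` mod `F`:
`∑_{Mᵢ = 6F} (1 - χ(3)) (χ w̄ᵢ)⁻¹ + 2 ∑_{Mᵢ = 3F} (1 - χ(3)) (χ w̄ᵢ)⁻¹ + 2 ∑_{Mᵢ = 2F} (χ w̄ᵢ)⁻¹
  + 4 ∑_{Mᵢ = F} (χ w̄ᵢ)⁻¹ = 0`
(`w̄ᵢ = wᵢ mod F`; the weights `φ(m)/φ(Mᵢ)` are `c/4, c/2, c/2, c` for `Mᵢ = 6F, 3F, 2F, F`,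
`c = φ(m)/φ(F)`, and the Euler factor `1 - χ(2)` of the levels `2F, 6F` is `1` since `χ(2) = 0`).
[cite: Aoki1983, Prop. 2.2 with Prop. 2.1; §9 (III-7) p. 50] -/
theorem IsHodge.rel_sixth_conductor_even [NeZero m] {r : ℕ} {α : Fin r → ZMod m} (h : IsHodge α)
    {F : ℕ} [NeZero F] (h2 : 2 ∣ F) (h3 : ¬ 3 ∣ F) (hFm : F ∣ m) {χ : DirichletCharacter ℂ F}
    (hχ : χ.Odd) (hprim : χ.IsPrimitive) (M : Fin r → ℕ) [∀ i, NeZero (M i)] (hM : ∀ i, M i ∣ m)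
    (w : (i : Fin r) → ZMod (M i)) (hw : ∀ i, IsUnit (w i))
    (hα : ∀ i, α i = ((m / M i : ℕ) : ZMod m) * ((ZMod.val (w i) : ℕ) : ZMod m))
    (hlev : ∀ i, F ∣ M i → M i = F ∨ M i = 2 * F ∨ M i = 3 * F ∨ M i = 6 * F) :
    ∑ i, (if M i = 6 * F then (1 - χ 3) * (χ (ZMod.cast (w i) : ZMod F))⁻¹
      else if M i = 3 * F then 2 * (1 - χ 3) * (χ (ZMod.cast (w i) : ZMod F))⁻¹
      else if M i = 2 * F then 2 * (χ (ZMod.cast (w i) : ZMod F))⁻¹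
      else if M i = F then 4 * (χ (ZMod.cast (w i) : ZMod F))⁻¹ else 0) = 0 := by
  classical
  have hm0 : m ≠ 0 := NeZero.ne m
  have hF0 : F ≠ 0 := NeZero.ne F
  have key := h.aoki_criterion hFm hχ hprim M hM w hw hα
  have hφF : ((F.totient : ℕ) : ℂ) ≠ 0 := by
    exact_mod_cast (Nat.totient_pos.mpr (Nat.pos_of_ne_zero hF0)).ne'
  set c : ℂ := (m.totient : ℂ) / (F.totient : ℂ) with hc
  have hc0 : c ≠ 0 := div_ne_zero
    (by exact_mod_cast (Nat.totient_pos.mpr (Nat.pos_of_ne_zero hm0)).ne') hφF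
  have hne12 : F ≠ 2 * F := by omega
  have hne13 : F ≠ 3 * F := by omega
  have hne16 : F ≠ 6 * F := by omega
  have hne23 : 2 * F ≠ 3 * F := by omega
  have hne26 : 2 * F ≠ 6 * F := by omega
  have hne36 : 3 * F ≠ 6 * F := by omega
  have hcop3 : Nat.Coprime 3 F := (Nat.Prime.coprime_iff_not_dvd Nat.prime_three).mpr h3
  have hχ2 : χ 2 = 0 := apply_two_eq_zero₂₇ h2 χ
  have h3nmem : (3 : ℕ) ∉ F.primeFactors := fun h ↦ h3 (Nat.dvd_of_mem_primeFactors h)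
  have h2F : (2 * F).primeFactors = F.primeFactors := by
    rw [Nat.primeFactors_mul (by norm_num) hF0, Nat.prime_two.primeFactors]
    exact Finset.union_eq_right.mpr (Finset.singleton_subset_iff.mpr
      (Nat.mem_primeFactors.mpr ⟨Nat.prime_two, h2, hF0⟩))
  have hpf2 : ∏ p ∈ (2 * F).primeFactors, (1 - χ (p : ZMod F)) = 1 := by
    rw [h2F]; exact prod_primeFactors_one_sub_eq_one₂₇ χ
  have hpf3 : ∏ p ∈ (3 * F).primeFactors, (1 - χ (p : ZMod F)) = 1 - χ 3 := by
    rw [Nat.primeFactors_mul (by norm_num) hF0, Nat.prime_three.primeFactors,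
      show ({3} ∪ F.primeFactors : Finset ℕ) = insert 3 F.primeFactors from rfl,
      Finset.prod_insert h3nmem, prod_primeFactors_one_sub_eq_one₂₇ χ, mul_one, Nat.cast_ofNat]
  have hpf6 : ∏ p ∈ (6 * F).primeFactors, (1 - χ (p : ZMod F)) = 1 - χ 3 := by
    have h2F0 : 2 * F ≠ 0 := by positivity
    have h3nmem' : (3 : ℕ) ∉ (2 * F).primeFactors := by rw [h2F]; exact h3nmem
    rw [show 6 * F = 3 * (2 * F) by ring, Nat.primeFactors_mul (by norm_num) h2F0,
      Nat.prime_three.primeFactors,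
      show ({3} ∪ (2 * F).primeFactors : Finset ℕ) = insert 3 (2 * F).primeFactors from rfl,
      Finset.prod_insert h3nmem', hpf2, mul_one, Nat.cast_ofNat]
  have ht2 : ((2 * F).totient : ℂ) = 2 * F.totient := by
    rw [Nat.totient_mul_of_prime_of_dvd Nat.prime_two h2]; push_cast; ring
  have ht3 : ((3 * F).totient : ℂ) = 2 * F.totient := by
    rw [Nat.totient_mul hcop3, show Nat.totient 3 = 2 by decide]; push_cast; ring
  have ht6 : ((6 * F).totient : ℂ) = 4 * F.totient := by
    rw [show 6 * F = 2 * (3 * F) by ring,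
      Nat.totient_mul_of_prime_of_dvd Nat.prime_two (h2.mul_left 3), Nat.totient_mul hcop3,
      show Nat.totient 3 = 2 by decide]
    push_cast; ring
  have hterm : ∀ i, (if F ∣ M i then ((m.totient : ℂ) / ((M i).totient : ℂ)) *
        (∏ p ∈ (M i).primeFactors, (1 - χ p)) * (χ (ZMod.cast (w i) : ZMod F))⁻¹ else 0) =
      (c / 4) * (if M i = 6 * F then (1 - χ 3) * (χ (ZMod.cast (w i) : ZMod F))⁻¹
        else if M i = 3 * F then 2 * (1 - χ 3) * (χ (ZMod.cast (w i) : ZMod F))⁻¹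
        else if M i = 2 * F then 2 * (χ (ZMod.cast (w i) : ZMod F))⁻¹
        else if M i = F then 4 * (χ (ZMod.cast (w i) : ZMod F))⁻¹ else 0) := by
    intro i
    by_cases hFi : F ∣ M i
    · rw [if_pos hFi]
      rcases hlev i hFi with h1 | h2' | h3' | h6'
      · -- exact level `F`
        have ht : ((M i).totient : ℂ) = F.totient := by rw [h1]
        have hp : ∏ p ∈ (M i).primeFactors, (1 - χ (p : ZMod F)) = 1 := by
          rw [h1]; exact prod_primeFactors_one_sub_eq_one₂₇ χ
        rw [ht, hp, if_neg (by rw [h1]; exact hne16), if_neg (by rw [h1]; exact hne13),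
          if_neg (by rw [h1]; exact hne12), if_pos h1, hc]
        ring
      · -- exact level `2F`
        have ht : ((M i).totient : ℂ) = 2 * F.totient := by rw [h2']; exact ht2
        have hp : ∏ p ∈ (M i).primeFactors, (1 - χ (p : ZMod F)) = 1 := by
          rw [h2']; exact hpf2
        rw [ht, hp, if_neg (by rw [h2']; exact hne26), if_neg (by rw [h2']; exact hne23), if_pos h2',
          hc]
        field_simp
        ring
      · -- exact level `3F`
        have ht : ((M i).totient : ℂ) = 2 * F.totient := by rw [h3']; exact ht3
        have hp : ∏ p ∈ (M i).primeFactors, (1 - χ (p : ZMod F)) = 1 - χ 3 := by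
          rw [h3']; exact hpf3
        rw [ht, hp, if_neg (by rw [h3']; exact hne36), if_pos h3', hc]
        field_simp
        ring
      · -- exact level `6F`
        have ht : ((M i).totient : ℂ) = 4 * F.totient := by rw [h6']; exact ht6
        have hp : ∏ p ∈ (M i).primeFactors, (1 - χ (p : ZMod F)) = 1 - χ 3 := by
          rw [h6']; exact hpf6
        rw [ht, hp, if_pos h6', hc]
        field_simp
    · have hne6 : ¬ M i = 6 * F := fun h' ↦ hFi (h' ▸ dvd_mul_left F 6)
      have hne3 : ¬ M i = 3 * F := fun h' ↦ hFi (h' ▸ dvd_mul_left F 3)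
      have hne2 : ¬ M i = 2 * F := fun h' ↦ hFi (h' ▸ dvd_mul_left F 2)
      have hne1 : ¬ M i = F := fun h1 ↦ hFi (h1 ▸ dvd_refl F)
      rw [if_neg hFi, if_neg hne6, if_neg hne3, if_neg hne2, if_neg hne1, mul_zero]
  rw [Finset.sum_congr rfl (fun i _ ↦ hterm i), ← Finset.mul_sum] at key
  exact (mul_eq_zero.mp key).resolve_left (div_ne_zero hc0 (by norm_num : (4 : ℂ) ≠ 0))

/-- **[Aoki1983, Prop. 2.2] at an EVEN conductor `F` prime to `3`, met at the exact levels
`F, 2F, 3F, 6F` — with character values.** Under the hypotheses of `IsHodge.rel_sixth_conductor_even`: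
`∑_{Mᵢ = 6F} (1 - conj χ(3)) χ(w̄ᵢ) + 2 ∑_{Mᵢ = 3F} (1 - conj χ(3)) χ(w̄ᵢ) + 2 ∑_{Mᵢ = 2F} χ(w̄ᵢ)
  + 4 ∑_{Mᵢ = F} χ(w̄ᵢ) = 0` for every odd primitive `χ` mod `F` (complex conjugate of
`rel_sixth_conductor_even`, `|χ(u)| = 1` on units): with `3v₃ = -1` the points of levels `6F`, `3F` are
`3`-twins `w̄, v₃w̄` of weights `1`, `2`, those of levels `2F`, `F` single points of weights `2`, `4`.
[cite: Aoki1983, Prop. 2.2; §9 (III-7) p. 50] -/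
theorem IsHodge.rel_sixth_conductor_even_conj [NeZero m] {r : ℕ} {α : Fin r → ZMod m}
    (h : IsHodge α) {F : ℕ} [NeZero F] (h2 : 2 ∣ F) (h3 : ¬ 3 ∣ F) (hFm : F ∣ m)
    {χ : DirichletCharacter ℂ F} (hχ : χ.Odd) (hprim : χ.IsPrimitive) (M : Fin r → ℕ)
    [∀ i, NeZero (M i)] (hM : ∀ i, M i ∣ m) (w : (i : Fin r) → ZMod (M i)) (hw : ∀ i, IsUnit (w i))
    (hα : ∀ i, α i = ((m / M i : ℕ) : ZMod m) * ((ZMod.val (w i) : ℕ) : ZMod m))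
    (hlev : ∀ i, F ∣ M i → M i = F ∨ M i = 2 * F ∨ M i = 3 * F ∨ M i = 6 * F) :
    ∑ i, (if M i = 6 * F then (1 - starRingEnd ℂ (χ 3)) * χ (ZMod.cast (w i) : ZMod F)
      else if M i = 3 * F then 2 * (1 - starRingEnd ℂ (χ 3)) * χ (ZMod.cast (w i) : ZMod F)
      else if M i = 2 * F then 2 * χ (ZMod.cast (w i) : ZMod F)
      else if M i = F then 4 * χ (ZMod.cast (w i) : ZMod F) else 0) = 0 := by
  classical
  have key := h.rel_sixth_conductor_even h2 h3 hFm hχ hprim M hM w hw hα hlev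
  -- conjugate: `(χ y)⁻¹ = conj (χ y)`
  have hinv : ∀ y : ZMod F, (χ y)⁻¹ = starRingEnd ℂ (χ y) := by
    intro y
    by_cases hy : IsUnit y
    · exact Complex.inv_eq_conj (χ.unit_norm_eq_one hy.unit ▸ by rw [IsUnit.unit_spec])
    · rw [χ.map_nonunit hy, inv_zero, map_zero]
  have c2 : starRingEnd ℂ (2 : ℂ) = 2 := map_ofNat _ 2
  have c4 : starRingEnd ℂ (4 : ℂ) = 4 := map_ofNat _ 4
  have hterm : ∀ i, (if M i = 6 * F then (1 - starRingEnd ℂ (χ 3)) * χ (ZMod.cast (w i) : ZMod F)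
      else if M i = 3 * F then 2 * (1 - starRingEnd ℂ (χ 3)) * χ (ZMod.cast (w i) : ZMod F)
      else if M i = 2 * F then 2 * χ (ZMod.cast (w i) : ZMod F)
      else if M i = F then 4 * χ (ZMod.cast (w i) : ZMod F) else 0) =
      starRingEnd ℂ (if M i = 6 * F then (1 - χ 3) * (χ (ZMod.cast (w i) : ZMod F))⁻¹
        else if M i = 3 * F then 2 * (1 - χ 3) * (χ (ZMod.cast (w i) : ZMod F))⁻¹
        else if M i = 2 * F then 2 * (χ (ZMod.cast (w i) : ZMod F))⁻¹
        else if M i = F then 4 * (χ (ZMod.cast (w i) : ZMod F))⁻¹ else 0) := by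
    intro i
    by_cases h6' : M i = 6 * F
    · rw [if_pos h6', if_pos h6', map_mul, map_sub, map_one, map_inv₀, ← hinv 3,
        ← hinv (ZMod.cast (w i)), inv_inv]
    · by_cases h3' : M i = 3 * F
      · rw [if_neg h6', if_pos h3', if_neg h6', if_pos h3', map_mul, map_mul, map_sub, map_one,
          map_inv₀, c2, ← hinv 3, ← hinv (ZMod.cast (w i)), inv_inv]
      · by_cases h2' : M i = 2 * F
        · rw [if_neg h6', if_neg h3', if_pos h2', if_neg h6', if_neg h3', if_pos h2', map_mul,
            map_inv₀, c2, ← hinv (ZMod.cast (w i)), inv_inv]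
        · by_cases h1 : M i = F
          · rw [if_neg h6', if_neg h3', if_neg h2', if_pos h1, if_neg h6', if_neg h3', if_neg h2',
              if_pos h1, map_mul, map_inv₀, c4, ← hinv, inv_inv]
          · rw [if_neg h6', if_neg h3', if_neg h2', if_neg h1, if_neg h6', if_neg h3', if_neg h2',
              if_neg h1, map_zero]
  rw [Finset.sum_congr rfl fun i _ ↦ hterm i, ← map_sum, key, map_zero]

/-- **[Aoki1983, Prop. 2.2] at the conductor `F = m/6` of a level `m = 6F` with `2 ∣ F`, `3 ∤ F`
(`12 ∣ m`, `9 ∤ m`) — Aoki's "`τ₆(α) ∈ A(m/6)`" for `ord₂ m ≥ 2`.** For a Hodge character of level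
`m = 6F` written as `αᵢ = (m/Mᵢ) wᵢ` and every odd primitive character `χ` mod `F`, the relation of
`IsHodge.rel_sixth_conductor_even_conj` holds with no hypothesis on the levels (every `Mᵢ ∣ 6F`
divisible by `F` is `F`, `2F`, `3F` or `6F`). (Primitive odd characters mod `F` exist only when
`4 ∣ F`, i.e. `24 ∣ m`; at `F ≡ 2 (mod 4)` the statement is vacuous.)
[cite: Aoki1983, Prop. 2.2; §9 (III-7) p. 50] -/
theorem IsHodge.rel_sixth_level_even {F : ℕ} [NeZero F] [NeZero (6 * F)] {r : ℕ}
    {α : Fin r → ZMod (6 * F)} (h : IsHodge α) (h2 : 2 ∣ F) (h3 : ¬ 3 ∣ F)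
    {χ : DirichletCharacter ℂ F} (hχ : χ.Odd) (hprim : χ.IsPrimitive) (M : Fin r → ℕ)
    [∀ i, NeZero (M i)] (hM : ∀ i, M i ∣ 6 * F) (w : (i : Fin r) → ZMod (M i))
    (hw : ∀ i, IsUnit (w i))
    (hα : ∀ i, α i = ((6 * F / M i : ℕ) : ZMod (6 * F)) * ((ZMod.val (w i) : ℕ) : ZMod (6 * F))) :
    ∑ i, (if M i = 6 * F then (1 - starRingEnd ℂ (χ 3)) * χ (ZMod.cast (w i) : ZMod F)
      else if M i = 3 * F then 2 * (1 - starRingEnd ℂ (χ 3)) * χ (ZMod.cast (w i) : ZMod F)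
      else if M i = 2 * F then 2 * χ (ZMod.cast (w i) : ZMod F)
      else if M i = F then 4 * χ (ZMod.cast (w i) : ZMod F) else 0) = 0 := by
  have hF0 : F ≠ 0 := NeZero.ne F
  refine h.rel_sixth_conductor_even_conj h2 h3 (dvd_mul_left F 6) hχ hprim M hM w hw hα
    fun i hFi ↦ ?_
  -- `M i = F t` with `t ∣ 6`
  obtain ⟨t, ht⟩ := hFi
  have ht6 : t ∣ 6 := by
    obtain ⟨s, hs⟩ := hM i
    refine ⟨s, Nat.eq_of_mul_eq_mul_left (Nat.pos_of_ne_zero hF0) ?_⟩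
    calc F * 6 = 6 * F := mul_comm _ _
      _ = M i * s := hs
      _ = F * (t * s) := by rw [ht]; ring
  have ht0 : t ≠ 0 := by rintro rfl; rw [mul_zero] at ht; exact (NeZero.ne (M i)) ht
  have htle : t ≤ 6 := Nat.le_of_dvd (by norm_num) ht6
  have ht1 : 1 ≤ t := Nat.pos_of_ne_zero ht0
  interval_cases t
  · exact Or.inl (by rw [ht, mul_one])
  · exact Or.inr (Or.inl (by rw [ht, mul_comm]))
  · exact Or.inr (Or.inr (Or.inl (by rw [ht, mul_comm])))
  · exact absurd ht6 (by norm_num)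
  · exact absurd ht6 (by norm_num)
  · exact Or.inr (Or.inr (Or.inr (by rw [ht, mul_comm])))

end SixthConductorEven

end FermatCharacter

end Literature.AlgebraicGeometry.HodgeTheory
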